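import Literature.MathematicalPhysics.QuantumFieldTheory.Balaban1983to89.B3AttachCounterterm

/-!
# `Balaban1983to89.B3AttachAllCounterterms` — T. Bałaban, *(Higgs)₂,₃ quantum fields in a finite volume. III. Renormalization*,
Commun. Math. Phys. **88** (1983) 411–445 [Balaban1983Higgs3]: p. 423, the graph surgery behind (2.3) — *"attaching the
corresponding graphs to the mass renormalization vertices"* — at ALL mass renormalization vertices at once, on the concrete model
`B3Cor23Concrete` / `B3IGraph`

statement-level skeleton of published theorems with citation tags; proofs where landed; nothing here is a claim about the Yang–Mills mass gap

PDF held: `paper:balaban1983-higgs-2-3-quantum-fields-finite-volume` (journal page = PDF page + 410); text `lit read` pp. 13, 16–17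
(pp. 423, 426–427); renders read as images by the gen-4 seat: `…/b2b-balaban-ref1/pages/1983-cmp88-higgs23-III/1983-cmp88-higgs23-
III-p006, p007, p013-x2.png` (pp. 416, 417, 423).
CITATION HEADER (lean-in-tree rule).  lit-balaban TYPED SKELETON (HOME `run/shared/lean/pub/lit-balaban/`), Phase 2, seat p18
(gen 5), unit `lit-balaban-p18`: SKELETON row **B3.Eq2.2-2.3** (owner r15; decls of record `B3Sect2Statements.graphDegree`,
`graphDegree_eq_22`), p. 423 [PDF 13], verbatim: *"In the general case we take the following definition, which in fact is an
inductive definition: D(G) = Σ_{v∈G} D_G(v) − d + (a sum of degrees of mass renormalization counterterms connected with the vertices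
of the graph G). (2.3) Thus the degree of G is the same as the degree of a graph G′ obtained from G by attaching the corresponding
graphs to the mass renormalization vertices."*  The gen-4 modules `B3AttachCounterterm` / `B3AttachCountertermDegree` construct G′ and
prove the sentence for ONE mass renormalization vertex of a `B3Cor23Concrete.Graph`.  THIS MODULE constructs G′ in the printed
generality: for a graph G of the model over ANY finite vertex type (`B3IGraph.IGraph`, so that the construction can be repeated on
its own output — the "inductive definition") and an arbitrary finite set S of its mass renormalization vertices (kind (1.7)), each
v ∈ S carrying the graph H_v = G₀ of its counterterm δm²_{G₀} (by (1.21)–(1.23) pp. 416–417 a graph of the self-energy Σ_ε with two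
external undifferentiated φ′-legs x₀, x₁ — *"the graph corresponding to δm_G is the same as for Σ_{εG}"*, p. 417), ALL the vertices
v ∈ S are deleted simultaneously and the graphs H_v inserted, the legs x₀, x₁ of H_v taking over the scalar lines of G that ended at
the two φ′-legs of v (a line of G joining two vertices of S becomes a line joining the corresponding attachment legs of their two
counterterm graphs; a line joining the two legs of one v ∈ S joins x₀ to x₁; an external leg of v leaves the corresponding x external).
The sibling `B3AttachAllCountertermsDegree` proves the sentence: D(G′) computed by (2.2) equals (2.3) for G, i.e.
D(G) + Σ_{v∈S} D(H_v).

WHAT IS FORMALISED (sorry-free; `def`s with bodies only, no `Prop` fact).  `CTGraph nbar` (a counterterm graph with its two marked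
attachment legs), `AttachAll G` (the set S ⊆ vertices of G of kind (1.7) and the family v ↦ H_v), the attached graph
`AttachAll.attachAll : IGraph nbar ({w // w ∉ S} ⊕ Σ v : S, vertices of H_v)` with its four structure axioms PROVED (`other'_ne`,
`other'_symm`, `other'_isLeft`, `exists_line'`) — the surgery is a genuine graph of the model's kind, over a vertex type of the same
shape, so it can be iterated (counterterm graphs inside counterterm graphs).
-/

namespace Literature.MathematicalPhysics.QuantumFieldTheory.Balaban1983to89.B3AttachAllCounterterms

open Finset B3Prop1 B3Sect2Statements B3VertexBridge B3Cor23Concrete B3OddVectorLoops B3IGraph B3AttachCounterterm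

variable {nbar : ℕ}

/-! ## Counterterm graphs with their attachment legs -/

/-- A counterterm graph ready for attachment (p. 423 with pp. 416–417): the graph H = G₀ of a mass renormalization counterterm from
δm²_k — a graph of Σ_ε, (1.21) — together with its two distinct external φ′-legs `x 0`, `x 1`, which carry no differentiation.
[cite: Balaban1983Higgs3, (2.3) p.423] -/
structure CTGraph (nbar : ℕ) where
  /-- the counterterm graph G₀ -/
  H : Graph nbar
  /-- its two attachment legs (φ′-legs) -/
  x : Fin 2 → SLeg H
  /-- they are distinct -/
  x_inj : Function.Injective x
  /-- they are external in H -/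
  ext : ∀ k, H.other ⟨(x k).1, .inl (x k).2⟩ = none
  /-- they carry no differentiation (a leg of index 0 of a vertex (1.8)/(1.9) is its D^η_B̃φ′-leg) -/
  undiff : ∀ k, ((x k).2 : ℕ) = 0 → (H.kind (x k).1).diffCount = 0

namespace CTGraph

variable (C : CTGraph nbar)

/-- The attachment legs as legs of H. [cite: Balaban1983Higgs3, (2.3) p.423] -/
def xleg (k : Fin 2) : Leg C.H.kind := ⟨(C.x k).1, .inl (C.x k).2⟩

/-- Reading a leg of H as a φ′-leg (none for A′-legs). [cite: Balaban1983Higgs3, (1.17) p.415] -/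
def toS : Leg C.H.kind → Option (SLeg C.H)
  | ⟨i, .inl j⟩ => some ⟨i, j⟩
  | ⟨_, .inr _⟩ => none

/-- kernel: an attachment leg read as a φ′-leg. [cite: Balaban1983Higgs3, (2.3) p.423] -/
theorem toS_xleg (k : Fin 2) : C.toS (C.xleg k) = some (C.x k) := rfl

/-- kernel: the attachment legs are distinct for distinct indices. [cite: Balaban1983Higgs3, (2.3) p.423] -/
theorem xleg_injective : Function.Injective C.xleg := fun k k' h =>
  C.x_inj (Option.some.inj ((C.toS_xleg k).symm.trans ((congrArg C.toS h).trans (C.toS_xleg k'))))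

/-- kernel: an internal leg of H is not an attachment leg (those are external in H). [cite: Balaban1983Higgs3, (2.3) p.423] -/
theorem ne_xleg_of_isSome {l : Leg C.H.kind} (h : (C.H.other l).isSome) (k : Fin 2) : l ≠ C.xleg k := by
  rintro rfl
  simp [xleg, C.ext k] at h

/-- kernel: the partner of a leg in H is not an attachment leg. [cite: Balaban1983Higgs3, (2.3) p.423] -/
theorem ne_xleg_of_other {l p : Leg C.H.kind} (h : C.H.other l = some p) (k : Fin 2) : p ≠ C.xleg k :=
  C.ne_xleg_of_isSome (by rw [C.H.other_symm _ _ h]; rfl) k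

/-- kernel: an A′-leg of H is not an attachment leg. [cite: Balaban1983Higgs3, (2.3) p.423] -/
theorem ne_xleg_inr (u : Fin C.H.nV) (j : Fin (C.H.kind u).vectorLegs) (k : Fin 2) :
    (⟨u, Sum.inr j⟩ : Leg C.H.kind) ≠ C.xleg k := by
  intro hk
  have := congrArg C.toS hk
  rw [C.toS_xleg] at this
  simp [toS] at this

/-- kernel: a φ′-leg of H other than x 0, x 1 is not an attachment leg. [cite: Balaban1983Higgs3, (2.3) p.423] -/
theorem ne_xleg_inl (u : Fin C.H.nV) (j : Fin (C.H.kind u).scalarLegs) (h : ∀ k, C.x k ≠ ⟨u, j⟩) (k : Fin 2) :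
    (⟨u, Sum.inl j⟩ : Leg C.H.kind) ≠ C.xleg k := by
  intro hk
  have := congrArg C.toS hk
  rw [C.toS_xleg] at this
  exact h k (by simpa [toS] using this.symm)

end CTGraph

/-! ## The data of the simultaneous attachment -/

/-- The data of the attachment at ALL mass renormalization vertices (p. 423): a finite set `S` of vertices of G of kind (1.7) —
those whose counterterm comes from δm²_k — and for each of them the graph G₀ of its counterterm with its attachment legs
(the vertices (1.7) outside `S` carry δm²_fin or δm²_{K,k}, degree 0, and are kept). [cite: Balaban1983Higgs3, (2.3) p.423] -/
structure AttachAll {ι : Type} (G : IGraph nbar ι) where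
  /-- the mass renormalization vertices receiving a counterterm graph -/
  S : Finset ι
  /-- they are vertices (1.7) -/
  hv : ∀ a : S, G.kind a.1 = .v17
  /-- the counterterm graphs -/
  ct : S → CTGraph nbar

namespace AttachAll

variable {ι : Type} [DecidableEq ι] {G : IGraph nbar ι} (T : AttachAll G)

/-- The counterterm graph H_v of the vertex v ∈ S. [cite: Balaban1983Higgs3, (2.3) p.423] -/
abbrev H (a : T.S) : Graph nbar := (T.ct a).H

omit [DecidableEq ι] in
/-- kernel: a vertex (1.7) has two φ′-legs. [cite: Balaban1983Higgs3, (1.7) p.413] -/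
theorem two_eq (a : T.S) : 2 = (G.kind a.1).scalarLegs := by rw [T.hv a]; rfl

omit [DecidableEq ι] in
/-- kernel: a vertex (1.7) has no A′-legs. [cite: Balaban1983Higgs3, (1.7) p.413] -/
theorem vec_eq (a : T.S) : (G.kind a.1).vectorLegs = 0 := by rw [T.hv a]; rfl

/-- The two φ′-legs of the vertex v ∈ S, as legs of G. [cite: Balaban1983Higgs3, (1.7) p.413] -/
def leg (a : T.S) (k : Fin 2) : ILeg G.kind := ⟨a.1, .inl (Fin.cast (T.two_eq a) k)⟩

/-- The vertices of the attached graph: those of G outside S, and those of all the counterterm graphs H_v, v ∈ S.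
[cite: Balaban1983Higgs3, (2.3) p.423] -/
def kind' : {w : ι // w ∉ T.S} ⊕ (Σ a : T.S, Fin (T.H a).nV) → VertexKind :=
  Sum.elim (fun w => G.kind w.1) (fun p => (T.H p.1).kind p.2)

/-- The attachment legs of H_v inside the attached graph. [cite: Balaban1983Higgs3, (2.3) p.423] -/
def X (a : T.S) (k : Fin 2) : ILeg T.kind' := ⟨Sum.inr ⟨a, ((T.ct a).x k).1⟩, Sum.inl ((T.ct a).x k).2⟩

/-- The legs of G inside the attached graph: a leg of a vertex outside S is kept; the leg k of v ∈ S is REPLACED by the attachment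
leg x k of H_v (this reroutes the lines of G ending in S into the counterterm graphs). [cite: Balaban1983Higgs3, (2.3) p.423] -/
def embG : ILeg G.kind → ILeg T.kind'
  | ⟨u, s⟩ => if h : u ∈ T.S then T.X ⟨u, h⟩ (AttachData.legIdx s) else ⟨Sum.inl ⟨u, h⟩, s⟩

/-- The legs of H_v inside the attached graph. [cite: Balaban1983Higgs3, (2.3) p.423] -/
def embH (a : T.S) : Leg (T.H a).kind → ILeg T.kind'
  | ⟨u, s⟩ => ⟨Sum.inr ⟨a, u⟩, s⟩

/-- Reading a leg of the attached graph back in G (none for legs of the counterterm graphs). [cite: Balaban1983Higgs3, (2.3) p.423] -/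
def projG : ILeg T.kind' → Option (ILeg G.kind)
  | ⟨Sum.inl w, s⟩ => some ⟨w.1, s⟩
  | ⟨Sum.inr _, _⟩ => none

/-- Reading a leg of the attached graph back in the counterterm graphs (none for legs of G). [cite: Balaban1983Higgs3, (2.3) p.423] -/
def projH : ILeg T.kind' → Option (Σ a : T.S, Leg (T.H a).kind)
  | ⟨Sum.inl _, _⟩ => none
  | ⟨Sum.inr p, s⟩ => some ⟨p.1, ⟨p.2, s⟩⟩

/-- The lines of the attached graph at a leg of the counterterm graph H_v: the attachment leg x k takes over the line of G that
ended at the leg k of v; every other leg of H_v keeps its line of H_v. [cite: Balaban1983Higgs3, (2.3) p.423] -/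
def otherH (a : T.S) (l : Leg (T.H a).kind) : Option (ILeg T.kind') :=
  if l = (T.ct a).xleg 0 then (G.other (T.leg a 0)).map T.embG
  else if l = (T.ct a).xleg 1 then (G.other (T.leg a 1)).map T.embG
  else ((T.H a).other l).map (T.embH a)

/-- The lines of the attached graph G′ (p. 423 *"obtained from G by attaching the corresponding graphs to the mass
renormalization vertices"*): a leg of an old vertex keeps its line of G (rerouted into H_v if it ended at v ∈ S); the legs of the
counterterm graphs as in `otherH`. [cite: Balaban1983Higgs3, (2.3) p.423] -/
def other' : ILeg T.kind' → Option (ILeg T.kind')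
  | ⟨Sum.inl w, s⟩ => (G.other ⟨w.1, s⟩).map T.embG
  | ⟨Sum.inr p, s⟩ => T.otherH p.1 ⟨p.2, s⟩

/-! ### Bookkeeping of the embeddings -/

omit [DecidableEq ι] in
/-- kernel: every leg of v ∈ S is its leg 0 or its leg 1. [cite: Balaban1983Higgs3, (1.7) p.413] -/
theorem exists_leg_eq (a : T.S) (s : Fin (G.kind a.1).scalarLegs ⊕ Fin (G.kind a.1).vectorLegs) :
    ∃ k, (⟨a.1, s⟩ : ILeg G.kind) = T.leg a k ∧ AttachData.legIdx s = k := by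
  rcases s with j | j
  · have hj : (j : ℕ) < 2 := by rw [T.two_eq a]; exact j.isLt
    refine ⟨⟨j, hj⟩, ?_, ?_⟩
    · show (⟨a.1, Sum.inl j⟩ : ILeg G.kind) = ⟨a.1, Sum.inl (Fin.cast (T.two_eq a) ⟨j, hj⟩)⟩
      rfl
    · apply Fin.ext
      unfold AttachData.legIdx
      split_ifs with h
      · simpa using h.symm
      · simp only [Sum.elim_inl] at h
        show (1 : ℕ) = j
        omega
  · exact absurd j.isLt (by have := T.vec_eq a; omega)

/-- kernel: the embedding of a leg of a vertex outside S. [cite: Balaban1983Higgs3, (2.3) p.423] -/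
theorem embG_of_not_mem {u : ι} (h : u ∉ T.S) (s : Fin (G.kind u).scalarLegs ⊕ Fin (G.kind u).vectorLegs) :
    T.embG ⟨u, s⟩ = ⟨Sum.inl ⟨u, h⟩, s⟩ := by
  simp [embG, h]

omit [DecidableEq ι] in
/-- kernel: the leg k of v has index k. [cite: Balaban1983Higgs3, (1.7) p.413] -/
theorem legIdx_leg (a : T.S) (k : Fin 2) :
    AttachData.legIdx (Sum.inl (Fin.cast (T.two_eq a) k) : Fin (G.kind a.1).scalarLegs ⊕ Fin (G.kind a.1).vectorLegs) = k := by
  apply Fin.ext; unfold AttachData.legIdx; fin_cases k <;> simp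

/-- kernel: the embedding of the leg k of v ∈ S is the attachment leg x k of H_v. [cite: Balaban1983Higgs3, (2.3) p.423] -/
theorem embG_leg (a : T.S) (k : Fin 2) : T.embG (T.leg a k) = T.X a k := by
  simp only [leg, embG, legIdx_leg]
  exact dif_pos a.2

/-- kernel: a leg of G in S embeds to an attachment leg, a leg elsewhere to an old leg. [cite: Balaban1983Higgs3, (2.3) p.423] -/
theorem embG_cases (p : ILeg G.kind) :
    (∃ a k, p = T.leg a k ∧ T.embG p = T.X a k) ∨ (∃ h : p.1 ∉ T.S, T.embG p = ⟨Sum.inl ⟨p.1, h⟩, p.2⟩) := by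
  obtain ⟨u, s⟩ := p
  by_cases h : u ∈ T.S
  · obtain ⟨k, hk, -⟩ := T.exists_leg_eq ⟨u, h⟩ s
    exact Or.inl ⟨⟨u, h⟩, k, hk, by rw [hk, embG_leg]⟩
  · exact Or.inr ⟨h, T.embG_of_not_mem h s⟩

/-- kernel: `projG` inverts `embG` outside S. [cite: Balaban1983Higgs3, (2.3) p.423] -/
theorem projG_embG_of_not_mem {p : ILeg G.kind} (h : p.1 ∉ T.S) : T.projG (T.embG p) = some p := by
  obtain ⟨u, s⟩ := p
  rw [T.embG_of_not_mem h]; rfl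

omit [DecidableEq ι] in
/-- kernel: attachment legs are not old legs. [cite: Balaban1983Higgs3, (2.3) p.423] -/
theorem projG_X (a : T.S) (k : Fin 2) : T.projG (T.X a k) = none := rfl

omit [DecidableEq ι] in
/-- kernel: `projH` inverts `embH`. [cite: Balaban1983Higgs3, (2.3) p.423] -/
theorem projH_embH (a : T.S) (p : Leg (T.H a).kind) : T.projH (T.embH a p) = some ⟨a, p⟩ := by
  obtain ⟨u, s⟩ := p; rfl

omit [DecidableEq ι] in
/-- kernel: the attachment leg read back in H_v. [cite: Balaban1983Higgs3, (2.3) p.423] -/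
theorem projH_X (a : T.S) (k : Fin 2) : T.projH (T.X a k) = some ⟨a, (T.ct a).xleg k⟩ := rfl

omit [DecidableEq ι] in
/-- kernel: `embH` of an attachment leg. [cite: Balaban1983Higgs3, (2.3) p.423] -/
theorem embH_xleg (a : T.S) (k : Fin 2) : T.embH a ((T.ct a).xleg k) = T.X a k := rfl

/-- kernel: old legs are not legs of the counterterm graphs. [cite: Balaban1983Higgs3, (2.3) p.423] -/
theorem projH_embG_of_not_mem {p : ILeg G.kind} (h : p.1 ∉ T.S) : T.projH (T.embG p) = none := by
  obtain ⟨u, s⟩ := p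
  rw [T.embG_of_not_mem h]; rfl

omit [DecidableEq ι] in
/-- kernel: the legs of v are distinct for distinct indices. [cite: Balaban1983Higgs3, (1.7) p.413] -/
theorem leg_injective (a : T.S) : Function.Injective (T.leg a) := by
  intro k k' h
  have := congrArg (fun l : ILeg G.kind => Sum.elim Fin.val Fin.val l.2) h
  exact Fin.ext (by simpa [leg] using this)

omit [DecidableEq ι] in
/-- kernel: the attachment legs inside G′ determine the counterterm graph and the index. [cite: Balaban1983Higgs3, (2.3) p.423] -/
theorem X_inj {a a' : T.S} {k k' : Fin 2} (h : T.X a k = T.X a' k') : a = a' ∧ k = k' := by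
  have hp := (T.projH_X a k).symm.trans ((congrArg T.projH h).trans (T.projH_X a' k'))
  simp only [Option.some.injEq] at hp
  obtain ⟨rfl, h2⟩ := Sigma.mk.inj_iff.mp hp
  exact ⟨rfl, (T.ct a).xleg_injective (eq_of_heq h2)⟩

/-- kernel: the line at an old leg. [cite: Balaban1983Higgs3, (2.3) p.423] -/
theorem other'_inl (w : {w : ι // w ∉ T.S}) (s : Fin (G.kind w.1).scalarLegs ⊕ Fin (G.kind w.1).vectorLegs) :
    T.other' ⟨Sum.inl w, s⟩ = (G.other ⟨w.1, s⟩).map T.embG := rfl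

/-- kernel: the line at a leg of a counterterm graph. [cite: Balaban1983Higgs3, (2.3) p.423] -/
theorem other'_embH_eq (a : T.S) (l : Leg (T.H a).kind) : T.other' (T.embH a l) = T.otherH a l := by
  obtain ⟨u, s⟩ := l; rfl

/-- kernel: the line at an attachment leg is the (rerouted) line of G at the corresponding leg of v.
[cite: Balaban1983Higgs3, (2.3) p.423] -/
theorem other'_X (a : T.S) (k : Fin 2) : T.other' (T.X a k) = (G.other (T.leg a k)).map T.embG := by
  rw [← T.embH_xleg a k, T.other'_embH_eq]
  unfold otherH
  split_ifs with h0 h1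
  · rw [(T.ct a).xleg_injective h0]
  · rw [(T.ct a).xleg_injective h1]
  · exfalso
    fin_cases k
    · exact h0 rfl
    · exact h1 rfl

/-- kernel: the line at a leg of H_v other than the attachment legs is its line of H_v. [cite: Balaban1983Higgs3, (2.3) p.423] -/
theorem other'_embH (a : T.S) {l : Leg (T.H a).kind} (h : ∀ k, l ≠ (T.ct a).xleg k) :
    T.other' (T.embH a l) = ((T.H a).other l).map (T.embH a) := by
  rw [T.other'_embH_eq]
  unfold otherH
  rw [if_neg (h 0), if_neg (h 1)]

omit [DecidableEq ι] in
/-- kernel: every leg of the attached graph is an old leg, an attachment leg, or another leg of a counterterm graph.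
[cite: Balaban1983Higgs3, (2.3) p.423] -/
theorem leg_cases (l : ILeg T.kind') :
    (∃ w s, l = ⟨Sum.inl w, s⟩) ∨ (∃ a k, l = T.X a k) ∨
      (∃ a, ∃ l' : Leg (T.H a).kind, (∀ k, l' ≠ (T.ct a).xleg k) ∧ l = T.embH a l') := by
  obtain ⟨i, s⟩ := l
  rcases i with w | ⟨a, u⟩
  · exact Or.inl ⟨w, s, rfl⟩
  · by_cases h : ∃ k, (⟨u, s⟩ : Leg (T.H a).kind) = (T.ct a).xleg k
    · obtain ⟨k, hk⟩ := h
      exact Or.inr (Or.inl ⟨a, k, (congrArg (T.embH a) hk).trans (T.embH_xleg a k)⟩)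
    · exact Or.inr (Or.inr ⟨a, ⟨u, s⟩, fun k hk => h ⟨k, hk⟩, rfl⟩)

/-! ### The structure axioms of the attached graph -/

/-- kernel: the lines of G′ join scalar legs to scalar legs and vector legs to vector legs. [cite: Balaban1983Higgs3, p.414] -/
theorem isLeft_embG (p : ILeg G.kind) : (T.embG p).2.isLeft = p.2.isLeft := by
  rcases T.embG_cases p with ⟨a, k, rfl, h⟩ | ⟨h, h'⟩
  · rw [h]; rfl
  · rw [h']; rfl

/-- kernel: symmetry of the lines of G′ at an old leg. [cite: Balaban1983Higgs3, p.415] -/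
theorem other'_embG_of_other {q p : ILeg G.kind} (h : G.other q = some p) :
    T.other' (T.embG p) = some (T.embG q) := by
  have hs := G.other_symm _ _ h
  rcases T.embG_cases p with ⟨a, k, rfl, hk⟩ | ⟨hp, hp'⟩
  · rw [hk, T.other'_X a k, hs]; rfl
  · rw [hp']
    show (G.other ⟨p.1, p.2⟩).map T.embG = _
    rw [show (⟨p.1, p.2⟩ : ILeg G.kind) = p from rfl, hs]; rfl

/-- kernel: "the other endpoint" of G′ is symmetric. [cite: Balaban1983Higgs3, p.415] -/
theorem other'_symm (l l' : ILeg T.kind') (h : T.other' l = some l') : T.other' l' = some l := by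
  rcases T.leg_cases l with ⟨w, s, rfl⟩ | ⟨a, k, rfl⟩ | ⟨a, m, hm, rfl⟩
  · rw [T.other'_inl] at h
    obtain ⟨p, hp, rfl⟩ := AttachData.map_eq_some h
    rw [T.other'_embG_of_other hp, T.embG_of_not_mem w.2]
  · rw [T.other'_X] at h
    obtain ⟨p, hp, rfl⟩ := AttachData.map_eq_some h
    rw [T.other'_embG_of_other hp, T.embG_leg]
  · rw [T.other'_embH a hm] at h
    obtain ⟨p, hp, rfl⟩ := AttachData.map_eq_some h
    rw [T.other'_embH a ((T.ct a).ne_xleg_of_other hp), (T.H a).other_symm _ _ hp]; rfl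

/-- kernel: a line of G′ has two distinct endpoints. [cite: Balaban1983Higgs3, p.415] -/
theorem other'_ne (l l' : ILeg T.kind') (h : T.other' l = some l') : l' ≠ l := by
  rcases T.leg_cases l with ⟨w, s, rfl⟩ | ⟨a, k, rfl⟩ | ⟨a, m, hm, rfl⟩
  · rw [T.other'_inl] at h
    obtain ⟨p, hp, rfl⟩ := AttachData.map_eq_some h
    intro heq
    rcases T.embG_cases p with ⟨a', k', rfl, hk⟩ | ⟨hpv, -⟩
    · have := congrArg T.projG heq
      rw [hk, T.projG_X] at this
      simp [projG] at this
    · have := congrArg T.projG heq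
      rw [T.projG_embG_of_not_mem hpv] at this
      exact G.other_ne _ _ hp (Option.some.inj this)
  · rw [T.other'_X] at h
    obtain ⟨p, hp, rfl⟩ := AttachData.map_eq_some h
    intro heq
    rcases T.embG_cases p with ⟨a', k', rfl, hk⟩ | ⟨hpv, -⟩
    · rw [hk] at heq
      obtain ⟨rfl, rfl⟩ := T.X_inj heq
      exact G.other_ne _ _ hp rfl
    · have := congrArg T.projH heq
      rw [T.projH_embG_of_not_mem hpv, T.projH_X] at this
      simp at this
  · rw [T.other'_embH a hm] at h
    obtain ⟨p, hp, rfl⟩ := AttachData.map_eq_some h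
    intro heq
    have := congrArg T.projH heq
    rw [T.projH_embH, T.projH_embH] at this
    simp only [Option.some.injEq] at this
    obtain ⟨-, h2⟩ := Sigma.mk.inj_iff.mp this
    exact (T.H a).other_ne _ _ hp (eq_of_heq h2)

/-- kernel: the lines of G′ preserve the leg type. [cite: Balaban1983Higgs3, p.414] -/
theorem other'_isLeft (l l' : ILeg T.kind') (h : T.other' l = some l') : l.2.isLeft = l'.2.isLeft := by
  rcases T.leg_cases l with ⟨w, s, rfl⟩ | ⟨a, k, rfl⟩ | ⟨a, m, hm, rfl⟩
  · rw [T.other'_inl] at h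
    obtain ⟨p, hp, rfl⟩ := AttachData.map_eq_some h
    rw [T.isLeft_embG]
    exact G.other_isLeft _ _ hp
  · rw [T.other'_X] at h
    obtain ⟨p, hp, rfl⟩ := AttachData.map_eq_some h
    rw [T.isLeft_embG, ← G.other_isLeft _ _ hp]
    rfl
  · rw [T.other'_embH a hm] at h
    obtain ⟨p, hp, rfl⟩ := AttachData.map_eq_some h
    obtain ⟨u, s⟩ := m
    obtain ⟨u', s'⟩ := p
    exact (T.H a).other_isLeft _ _ hp

/-- kernel: G′ has an internal line (a line of G is kept, possibly rerouted). [cite: Balaban1983Higgs3, p.415] -/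
theorem exists_line' : ∃ l, (T.other' l).isSome := by
  obtain ⟨q, hq⟩ := G.exists_line
  obtain ⟨p, hp⟩ := Option.isSome_iff_exists.mp hq
  exact ⟨T.embG p, by rw [T.other'_embG_of_other hp]; rfl⟩

/-- **p. 423** [PDF 13], the graph G′ *"obtained from G by attaching the corresponding graphs to the mass renormalization
vertices"* — ALL of them at once: the ATTACHED GRAPH of the data `A` (every v ∈ S deleted and its counterterm graph H_v inserted,
the legs x 0, x 1 of H_v taking over the lines at the legs of v), a graph of the model over the vertex type
{w ∉ S} ⊕ Σ_{v∈S} (vertices of H_v). [cite: Balaban1983Higgs3, (2.3) p.423] -/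
def attachAll : IGraph nbar ({w : ι // w ∉ T.S} ⊕ (Σ a : T.S, Fin (T.H a).nV)) where
  kind := T.kind'
  adm i := match i with
    | .inl w => G.adm w.1
    | .inr p => (T.H p.1).adm p.2
  other := T.other'
  other_ne := T.other'_ne
  other_symm := T.other'_symm
  other_isLeft := T.other'_isLeft
  exists_line := T.exists_line'

end AttachAll

end Literature.MathematicalPhysics.QuantumFieldTheory.Balaban1983to89.B3AttachAllCounterterms
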